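import Summits.QuantumFields.BalabanUV.Beta.HarmonicMeasureBoundD4

/-!
# `Summit.QuantumFields.BalabanUV.Beta.GreenNewtonBoundD4` — THE POINTWISE GREEN'S-FUNCTION BOUND FOR THE MODEL IN d = 4, KERNEL:
# `green_c B z y ≤ (3/(2c₀²))·1/(|z − y|² + 3) ≤ 3/(c₀²·(dist(z,y) + 1)²)` for EVERY sub-domain `B` of a no-wrap torus box, every
# pole `y` and every site `z` — the ONE pointwise hypothesis of co-owner beta-d4-p2's `GreenGradientRowSum` (GR2), discharged in d = 4

HONEST FRAMING (page 1 of everything in this cell).  Discharging `FlowStep.BetaPertH` would make Bałaban's ultraviolet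
stability UNCONDITIONAL — a constructive-QFT result; it is NOT the continuum limit and NOT the Clay problem.  This module
discharges nothing of `BetaPertH`; it is [folklore] discrete potential theory for the FREE Laplacian of the torus MODEL (constant bond
weight, flat transport `U = 1`), kernel-checked, by CO-OWNER #3 of binder row D4 (unit `b2b-balaban-beta-d4-p3`, road P3 «reduction
road», gen 13).  HONEST DEPENDENCY: continuum YM on T⁴ ⇐ BetaPertH ∧ nine spine estimates (0/9 proved); BetaPertH ⇐ (D1) ∧ (D4) ∧
CAP+tail; G-an2-4 gates asym, D1 and NE2/3/4.

THE POINT.  O.2 item (i) of row D4's MODEL programme (the GRADIENT member (3.42)₂'s SHAPE for the flat constant-weight torus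
Laplacian) is being built by co-owner beta-d4-p2 as the chain GR1 `HarmonicGradientInterior` (landed) → GR2 `GreenGradientRowSum` →
GR3 `GradientMemberBox`; GR2 bounds `Σ_{y∈B} |green B (x+e_μ) y − green B x y|` under ONE pointwise hypothesis
`green B x′ y ≤ K·((dist x′ y + 1)^{d−2})⁻¹` (journal l.≈24217, 2026-08-21T00:50:31Z: «your d = 4 Newton-potential bound discharges it»).
THIS FILE DISCHARGES THAT HYPOTHESIS FOR d = 4, for every sub-domain of a no-wrap box at once, by the comparison argument of
`HarmonicMeasureBoundD4` §2 run with the pole at an ARBITRARY site `y` (there: the centre of a Euclidean ball only):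
* §1 **`green_le_newton`** — constant weight `c ≡ c₀ ≠ 0`, `B` inside a box `{dist(·,x₀) ≤ D}` with `2D + 2 ≤ N_μ` (so that the
  Dirichlet problem on `B` is well posed: file 15b's box supersolution), and every `x ∈ B` below half the period as seen from the pole
  `y` (`2(δ_μ(x,y) + 1) ≤ N_μ`); then for EVERY `z`: `green_c B z y ≤ (3/(2c₀²))·ψ_y(z)`, `ψ_y(z) = 1/(Σ_μ δ_μ(z,y)² + 3)` — comparison
  `GraphGreenFunction.green_le_of_supersolution` with `w = (3/(2c₀²))·ψ_y ≥ 0`: `W·w − Nw = (3/2)(8ψ_y − Σ_± ψ_y(· ± e_μ)) ≥ 0` on `B`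
  (`LatticeNewtonPotentialD4.newton_superharmonic_d4`) and `= (3/2)·(8/3 − 2) = 1` at the pole (`newton_sum_centre_d4`, `newton_centre_d4`);
* §2 **`green_le_newton_box`** — the hypothesis-free form on a box twice below half the period: `B ⊆ {dist(·,x₀) ≤ D}`, `4D + 2 ≤ N_μ`
  ⟹ `green_c B z y ≤ (3/(2c₀²))/(Σ_μ δ_μ(z,y)² + 3)` for ALL `z, y` (an exterior pole gives `0`; an interior pole is within `2D` of every
  site of `B` coordinatewise);
* §3 **`newton_le_inv_dist_sq`** — the sup-distance form of the potential: `(3/2)/(Σ_μ δ_μ(z,y)² + 3) ≤ 3/(dist(z,y) + 1)²`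
  (`dist ≤ ⌊|z − y|⌋`, `⌊|z − y|⌋² ≤ Σ δ²`, `(t+1)² ≤ 2t² + 2`);
* §4 ENDs for the consumer, BY NAME: **`green_le_inv_dist_sq`** `green_c B z y ≤ 3/(c₀²·(dist z y + 1)²)`, **`green_le_inv_dist_pow`**
  (the same with the exponent written `4 − 2`, the literal `d − 2` of GR2 at `d = 4`), and the unit-weight ball instances
  **`green_box_le_inv_dist_sq`** ∕ **`green_unit_le_inv_dist_sq`** (`K = 3`).
So in d = 4 the constant of GR2's hypothesis is `K = 3/c₀²`, level-free and volume-free, side condition `4D + 2 ≤ N_μ` (inside GR1's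
`10R + 4 ≤ N_μ` at `D = 2R + 2`… the consumer picks `D`).  General `d ≥ 3` along these lines would use `ψ = (|x|² + a_d)^{−(d−2)/2}`
(not in the tree); d = 4 is Bałaban's dimension and the one the row needs.

LOCATORS (shape only, nothing printed asserted; ABSOLUTE RULE): [Balaban1985BackgroundPropagators] Thm 3.1 (3.42) p. 397 (gradient
member); [Balaban1983RegularityDecay] Lemma 2.2 (2.17) pp. 577–578; Lawler–Limic, Random Walk: A Modern Introduction (2010) Prop. 6.3.2 ∕
Lemma 6.3.7 (Green's function of a ball vs the potential kernel — the classical statement this file proves in its d = 4 lattice-torus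
form with an explicit constant, rather than cites).  Row D4: NO class change for Bałaban (critical-path width 0; D4 DISCHARGE NO DATE);
NOT BetaPertH, NOT continuum, NOT Clay, NOT summit progress.
-/

open scoped BigOperators
open Finset

namespace Summit.QuantumFields.BalabanUV.Beta.GreenNewtonBoundD4

open Literature.MathematicalPhysics.QuantumFieldTheory.Balaban1983to89
open Literature.MathematicalPhysics.QuantumFieldTheory.Balaban1983to89.B9Thm37GluePU (bsrc btgt bsrc_apply btgt_apply)
open B4Sect5Torus (ccoord)
open B5TorusCover (UT)
open B5Leibniz121 (up dn)
open Summit.QuantumFields.BalabanUV.Beta.TorusBoxSupersolution (sum_tgt_const sum_src_const wsum_tgt_const wsum_src_const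
  exists_unit_supersolution_box)
open Summit.QuantumFields.BalabanUV.Beta.GraphGreenFunction (green green_le_of_supersolution green_eq_zero_of_not_mem_right)
open Summit.QuantumFields.BalabanUV.Beta.TorusBallMeanValue (sqRad erad dist_le_of_erad_le)
open Summit.QuantumFields.BalabanUV.Beta.LatticeNewtonPotentialD4 (newton_superharmonic_d4 newton_sum_centre_d4 newton_centre_d4)

noncomputable section

variable {N : Fin 4 → ℕ} [∀ i, NeZero (N i)]

/-! ## §1 Comparison with the Newton potential centred at an arbitrary pole -/

/-- **THE GREEN'S FUNCTION IS DOMINATED BY THE SMOOTHED NEWTON POTENTIAL CENTRED AT THE POLE (d = 4).**  Unit torus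
`Π_{μ<4} ℤ/N_μ`, nearest-neighbour bonds `bsrc∕btgt`, CONSTANT bond weight `c ≡ c₀ ≠ 0`; a finite set `B` of sites inside a box
`{dist(·,x₀) ≤ D}` with `2D + 2 ≤ N_μ` for every `μ`, and a pole `y` such that every `x ∈ B` is below half the period as seen from
`y` (`2(δ_μ(x,y) + 1) ≤ N_μ`).  Then for every site `z`:
`green_c B z y ≤ (3/(2c₀²))·ψ_y(z)`, `ψ_y(z) = 1/(Σ_μ δ_μ(z,y)² + 3)`.
Proof: `GraphGreenFunction.green_le_of_supersolution` (Dirichlet data from file 15b's box supersolution) with the comparison function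
`w = (3/(2c₀²))·ψ_y`: `w ≥ 0` everywhere, `W·w − Nw = (3/2)·(8ψ_y − Σ_μ(ψ_y(· + e_μ) + ψ_y(· − e_μ))) ≥ 0` on `B`
(`newton_superharmonic_d4`), and `= (3/2)(8/3 − 2) = 1` at `x = y` (`newton_centre_d4`, `newton_sum_centre_d4`). [folklore] -/
theorem green_le_newton {c : UT N × Fin 4 → ℝ} {c₀ : ℝ} (hc : ∀ b, c b = c₀) (hc₀ : c₀ ≠ 0) (B : Finset (UT N)) (y : UT N)
    (ψ : UT N → ℝ) (hψ : ∀ z, ψ z = 1 / ((sqRad y z : ℝ) + 3))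
    (x₀ : UT N) {D : ℕ} (hBD : ∀ x ∈ B, dist x x₀ ≤ D) (hD : ∀ μ, 2 * D + 2 ≤ N μ)
    (hwrap : ∀ x ∈ B, ∀ μ, 2 * ((ccoord N (UT.toSite N x) (UT.toSite N y) μ : ℕ) + 1) ≤ N μ) (z : UT N) :
    green bsrc btgt c B z y ≤ 3 / (2 * c₀ ^ 2) * ψ z := by
  classical
  set w : UT N → ℝ := fun z => 3 / (2 * c₀ ^ 2) * ψ z with hw
  have hψ0 : ∀ z, 0 ≤ ψ z := fun z => by rw [hψ]; positivity
  have hK0 : 0 ≤ 3 / (2 * c₀ ^ 2) := by positivity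
  -- Dirichlet data: the box unit supersolution of file 15b
  obtain ⟨w₀, hw₀0, -, hw₀⟩ := exists_unit_supersolution_box hc hc₀ x₀ hD
  have hsub : ∀ x ∈ B, x ∈ univ.filter (fun x : UT N => dist x x₀ ≤ D) :=
    fun x hx => mem_filter.mpr ⟨mem_univ _, hBD x hx⟩
  show green bsrc btgt c B z y ≤ w z
  refine green_le_of_supersolution bsrc btgt c B w₀ hw₀0 (fun x hx => hw₀ x (hsub x hx)) y w
    (fun x _ => mul_nonneg hK0 (hψ0 x)) (fun x hx => ?_) z
  -- the supersolution inequality at `x ∈ B`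
  rw [sum_tgt_const hc, sum_src_const hc, wsum_tgt_const hc, wsum_src_const hc]
  have hNsum : ∑ μ, w (dn x μ) + ∑ μ, w (up x μ) = 3 / (2 * c₀ ^ 2) * (∑ μ, ψ (up x μ) + ∑ μ, ψ (dn x μ)) := by
    simp only [hw, ← Finset.mul_sum]
    ring
  have hwx : w x = 3 / (2 * c₀ ^ 2) * ψ x := rfl
  have hc2 : c₀ ^ 2 ≠ 0 := pow_ne_zero 2 hc₀
  have hgoal : ((4 : ℕ) * c₀ ^ 2 + (4 : ℕ) * c₀ ^ 2) * w x - (c₀ ^ 2 * ∑ μ, w (dn x μ) + c₀ ^ 2 * ∑ μ, w (up x μ)) =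
      3 / 2 * (8 * ψ x - (∑ μ, ψ (up x μ) + ∑ μ, ψ (dn x μ))) := by
    rw [← mul_add (c₀ ^ 2), hNsum, hwx]
    push_cast
    field_simp
    ring
  rw [hgoal]
  have hsh := newton_superharmonic_d4 y ψ hψ x (hwrap x hx)
  rw [Finset.sum_add_distrib] at hsh
  by_cases hx0 : x = y
  · subst hx0
    rw [if_pos rfl]
    have hcen := newton_sum_centre_d4 x ψ hψ (fun μ => by have := hD μ; omega)
    rw [Finset.sum_add_distrib] at hcen
    rw [hcen, newton_centre_d4 x ψ hψ]
    norm_num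
  · rw [if_neg hx0]
    linarith

/-! ## §2 The hypothesis-free form on a box twice below half the period -/

omit [∀ i, NeZero (N i)] in
/-- Each circular coordinate distance is at most the sup-distance: `δ_μ(x,y) ≤ dist(x,y)`. [folklore] -/
theorem ccoord_le_dist (x y : UT N) [∀ i, NeZero (N i)] (μ : Fin 4) :
    ((ccoord N (UT.toSite N x) (UT.toSite N y) μ : ℕ) : ℝ) ≤ dist x y := by
  rw [UT.dist_eq]
  unfold B4Sect5Torus.tdist
  exact_mod_cast Finset.le_sup (f := ccoord N (UT.toSite N x) (UT.toSite N y)) (Finset.mem_univ μ)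

/-- Two sites of a box `{dist(·,x₀) ≤ D}` with `4D + 2 ≤ N_μ` see each other below half the period:
`2(δ_μ(x,y) + 1) ≤ N_μ`. [folklore] -/
theorem nowrap_of_box (x₀ x y : UT N) {D : ℕ} (hx : dist x x₀ ≤ D) (hy : dist y x₀ ≤ D) (hD : ∀ μ, 4 * D + 2 ≤ N μ)
    (μ : Fin 4) : 2 * ((ccoord N (UT.toSite N x) (UT.toSite N y) μ : ℕ) + 1) ≤ N μ := by
  have h1 := ccoord_le_dist x y μ
  have h2 : dist x y ≤ 2 * D := by
    have := dist_triangle x x₀ y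
    rw [dist_comm x₀ y] at this
    linarith
  have h3 : ((ccoord N (UT.toSite N x) (UT.toSite N y) μ : ℕ) : ℝ) ≤ 2 * D := h1.trans h2
  have h4 : ccoord N (UT.toSite N x) (UT.toSite N y) μ ≤ 2 * D := by exact_mod_cast h3
  have := hD μ
  omega

/-- **THE POINTWISE GREEN BOUND ON A BOX, NO HYPOTHESIS (d = 4).**  Constant weight `c ≡ c₀ ≠ 0`, `B ⊆ {dist(·,x₀) ≤ D}` with
`4D + 2 ≤ N_μ` for every `μ`; then for ALL sites `z, y`:
`green_c B z y ≤ (3/(2c₀²))·1/(Σ_μ δ_μ(z,y)² + 3)`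
(pole outside `B`: the Green's function vanishes, `GraphGreenFunction.green_eq_zero_of_not_mem_right`; pole inside: §1 with
`nowrap_of_box`). [folklore] -/
theorem green_le_newton_box {c : UT N × Fin 4 → ℝ} {c₀ : ℝ} (hc : ∀ b, c b = c₀) (hc₀ : c₀ ≠ 0) (B : Finset (UT N))
    (x₀ : UT N) {D : ℕ} (hBD : ∀ x ∈ B, dist x x₀ ≤ D) (hD : ∀ μ, 4 * D + 2 ≤ N μ) (z y : UT N) :
    green bsrc btgt c B z y ≤ 3 / (2 * c₀ ^ 2) * (1 / ((sqRad y z : ℝ) + 3)) := by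
  classical
  have hD' : ∀ μ, 2 * D + 2 ≤ N μ := fun μ => by have := hD μ; omega
  by_cases hy : y ∈ B
  · exact green_le_newton hc hc₀ B y (fun z => 1 / ((sqRad y z : ℝ) + 3)) (fun _ => rfl) x₀ hBD hD'
      (fun x hx μ => nowrap_of_box x₀ x y (hBD x hx) (hBD y hy) hD μ) z
  · obtain ⟨w₀, hw₀0, -, hw₀⟩ := exists_unit_supersolution_box hc hc₀ x₀ hD'
    have hsub : ∀ x ∈ B, x ∈ univ.filter (fun x : UT N => dist x x₀ ≤ D) :=
      fun x hx => mem_filter.mpr ⟨mem_univ _, hBD x hx⟩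
    rw [green_eq_zero_of_not_mem_right bsrc btgt c B w₀ hw₀0 (fun x hx => hw₀ x (hsub x hx)) z y hy]
    positivity

/-! ## §3 The potential in sup-distance currency -/

/-- `dist(z,y)² ≤ Σ_μ δ_μ(z,y)²` (`dist ≤ ⌊|z − y|⌋` by `TorusBallMeanValue.dist_le_of_erad_le`, and `⌊√q⌋² ≤ q`). [folklore] -/
theorem dist_sq_le_sqRad (z y : UT N) : dist z y ^ 2 ≤ (sqRad y z : ℝ) := by
  have h1 : dist z y ≤ (erad y z : ℝ) := dist_le_of_erad_le y z le_rfl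
  have h2 : erad y z ^ 2 ≤ sqRad y z := Nat.sqrt_le' (sqRad y z)
  have h2' : ((erad y z : ℕ) : ℝ) ^ 2 ≤ (sqRad y z : ℝ) := by exact_mod_cast h2
  have h0 : 0 ≤ dist z y := dist_nonneg
  nlinarith

/-- **`(3/2)/(Σ_μ δ_μ(z,y)² + 3) ≤ 3/(dist(z,y) + 1)²`** (`(t+1)² ≤ 2t² + 2 ≤ 2q + 6` for `0 ≤ t`, `t² ≤ q`). [folklore] -/
theorem newton_le_inv_dist_sq (z y : UT N) :
    3 / 2 * (1 / ((sqRad y z : ℝ) + 3)) ≤ 3 / (dist z y + 1) ^ 2 := by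
  have h1 := dist_sq_le_sqRad z y
  have h0 : 0 ≤ dist z y := dist_nonneg
  have hq : (0 : ℝ) ≤ (sqRad y z : ℝ) := by positivity
  rw [show 3 / 2 * (1 / ((sqRad y z : ℝ) + 3)) = 3 / (2 * ((sqRad y z : ℝ) + 3)) by field_simp]
  rw [div_le_div_iff₀ (by positivity) (by positivity)]
  nlinarith

/-! ## §4 ENDs for the consumer (GR2's pointwise hypothesis at d = 4, by name) -/

/-- **THE POINTWISE GREEN BOUND IN SUP-DISTANCE CURRENCY (d = 4), NO HYPOTHESIS**: constant weight `c ≡ c₀ ≠ 0`,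
`B ⊆ {dist(·,x₀) ≤ D}`, `4D + 2 ≤ N_μ` ⟹ for all `z, y`: `green_c B z y ≤ 3/(c₀²·(dist(z,y) + 1)²)`. [folklore] -/
theorem green_le_inv_dist_sq {c : UT N × Fin 4 → ℝ} {c₀ : ℝ} (hc : ∀ b, c b = c₀) (hc₀ : c₀ ≠ 0) (B : Finset (UT N))
    (x₀ : UT N) {D : ℕ} (hBD : ∀ x ∈ B, dist x x₀ ≤ D) (hD : ∀ μ, 4 * D + 2 ≤ N μ) (z y : UT N) :
    green bsrc btgt c B z y ≤ 3 / (c₀ ^ 2 * (dist z y + 1) ^ 2) := by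
  have h1 := green_le_newton_box hc hc₀ B x₀ hBD hD z y
  have h2 := newton_le_inv_dist_sq z y
  have hc2 : 0 < c₀ ^ 2 := by positivity
  calc green bsrc btgt c B z y ≤ 3 / (2 * c₀ ^ 2) * (1 / ((sqRad y z : ℝ) + 3)) := h1
    _ = (c₀ ^ 2)⁻¹ * (3 / 2 * (1 / ((sqRad y z : ℝ) + 3))) := by field_simp
    _ ≤ (c₀ ^ 2)⁻¹ * (3 / (dist z y + 1) ^ 2) := mul_le_mul_of_nonneg_left h2 (by positivity)
    _ = 3 / (c₀ ^ 2 * (dist z y + 1) ^ 2) := by field_simp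

/-- The same END with the exponent written `4 − 2` — the literal `(dist z y + 1)^{d−2}` of GR2's hypothesis at `d = 4`:
`green_c B z y ≤ (3/c₀²)·((dist(z,y) + 1)^{4−2})⁻¹`. [folklore] -/
theorem green_le_inv_dist_pow {c : UT N × Fin 4 → ℝ} {c₀ : ℝ} (hc : ∀ b, c b = c₀) (hc₀ : c₀ ≠ 0) (B : Finset (UT N))
    (x₀ : UT N) {D : ℕ} (hBD : ∀ x ∈ B, dist x x₀ ≤ D) (hD : ∀ μ, 4 * D + 2 ≤ N μ) (z y : UT N) :
    green bsrc btgt c B z y ≤ 3 / c₀ ^ 2 * ((dist z y + 1) ^ (4 - 2))⁻¹ := by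
  have h := green_le_inv_dist_sq hc hc₀ B x₀ hBD hD z y
  have hc2 : 0 < c₀ ^ 2 := by positivity
  have hd : 0 < dist z y + 1 := by have : 0 ≤ dist z y := dist_nonneg; linarith
  rw [show (4 : ℕ) - 2 = 2 by norm_num]
  calc green bsrc btgt c B z y ≤ 3 / (c₀ ^ 2 * (dist z y + 1) ^ 2) := h
    _ = 3 / c₀ ^ 2 * ((dist z y + 1) ^ 2)⁻¹ := by field_simp

/-- The END on the box itself, `B = {dist(·,x₀) ≤ D}`: `green_c B z y ≤ 3/(c₀²·(dist(z,y) + 1)²)` for `4D + 2 ≤ N_μ`. [folklore] -/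
theorem green_box_le_inv_dist_sq {c : UT N × Fin 4 → ℝ} {c₀ : ℝ} (hc : ∀ b, c b = c₀) (hc₀ : c₀ ≠ 0) (x₀ : UT N) {D : ℕ}
    (hD : ∀ μ, 4 * D + 2 ≤ N μ) (z y : UT N) :
    green bsrc btgt c (univ.filter (fun x : UT N => dist x x₀ ≤ D)) z y ≤ 3 / (c₀ ^ 2 * (dist z y + 1) ^ 2) :=
  green_le_inv_dist_sq hc hc₀ _ x₀ (fun _ hx => (mem_filter.mp hx).2) hD z y

/-- The unit-weight END: `B ⊆ {dist(·,x₀) ≤ D}`, `4D + 2 ≤ N_μ` ⟹ `green₁ B z y ≤ 3/(dist(z,y) + 1)²` — constant `K = 3` in d = 4.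
[folklore] -/
theorem green_unit_le_inv_dist_sq (B : Finset (UT N)) (x₀ : UT N) {D : ℕ} (hBD : ∀ x ∈ B, dist x x₀ ≤ D)
    (hD : ∀ μ, 4 * D + 2 ≤ N μ) (z y : UT N) :
    green bsrc btgt (fun _ : UT N × Fin 4 => (1 : ℝ)) B z y ≤ 3 / (dist z y + 1) ^ 2 := by
  have h := green_le_inv_dist_sq (c := fun _ : UT N × Fin 4 => (1 : ℝ)) (c₀ := 1) (fun _ => rfl) one_ne_zero B x₀ hBD hD z y
  simpa using h

end

end Summit.QuantumFields.BalabanUV.Beta.GreenNewtonBoundD4
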